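import Summits.NavierStokesRegularity.NavierStokesRegularity.Theses.FilamentSkeletonRss
import Summits.NavierStokesRegularity.NavierStokesRegularity.Theorems.FilamentSkeletonRssCoreGluingInvertibilitySplit
import Summits.NavierStokesRegularity.NavierStokesRegularity.Theorems.CoreGluing.Negative.ThresholdLoadBearing
import Summits.NavierStokesRegularity.NavierStokesRegularity.Theorems.CoreLinearInvertibility.Negative.MassZeroLoadBearing
import Summits.NavierStokesRegularity.NavierStokesRegularity.Theorems.CoreGluingGivenInvertibility.Negative.GaussianCoreRange

/-!
# Disproof of `CoreGluingGivenInvertibility` (stmt-NavierStokesRegularity-17944) — findings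

Work file of the crux disprover (cdisprove), cycle 1 (2026-08-17).  Prose only in docstrings.
Crux (route `FilamentSkeletonRss`, rank 5, rev 5):
`CoreGluingGivenInvertibility := CoreLinearInvertibility → CoreGluing`
`= CoreLinearInvertibility → SkeletonEquilibrium → RssProfileExists` (`crux_iff`, `Iff.rfl`).

## Verdict of this cycle: NO KILL — the statement resists; two NEGATIVE lemmas landed (§C).

* **Structure (§A).**  The three components are CLOSED propositions with no shared variable (the
  profile's `α` is not tied to the skeleton's, the operator's `λ` not to the skeleton's strain), so
  `¬ crux ↔ CoreLinearInvertibility ∧ SkeletonEquilibrium ∧ ¬ RssProfileExists`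
  (tree p151377 `not_coreGluingGivenInvertibility_iff`, restated `not_crux_iff`).  A refutation needs ALL of:
  the sibling's linear lemma (stmt-17973; believed TRUE — `Cruxes/CoreLinearInvertibility/Disproof.lean`,
  three independent numerics, `λ = 0` is Gallay–Wayne with `c = 1`), the 2001 skeleton theorem as typed
  (stmt-15400; believed FALSE, credence 0.85 — Kelvin-sonic obstruction, `Cruxes/SkeletonEquilibrium/…`,
  negation lines seated there), and the rotating-self-similar Liouville theorem for EVERY `α ≠ 0` in the
  Type-I mild class (`¬ RssProfileExists`; Tsai Conj. 8.9 = Pineau–Vicol Conj. 1.1, OPEN: arXiv:2607.09619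
  has only `|α| ≪ 1` and `|α| ≫ 1` at fixed `C₀`).  So the most probable truth value of the crux is TRUE,
  VACUOUSLY (`crux_of_not_skeletonEquilibrium`, the lead's picked line `Sketch`), and a disproof is doubly
  out of reach: it would need `SkeletonEquilibrium` TRUE and Perelman's conjecture PROVED.  This is WHY it
  resists.  No junk route either (§D).
* **Load-bearing analysis of the two hypotheses (§B).**
  - Drop `CoreLinearInvertibility`: the crux becomes its parent `CoreGluing` (`withoutCLI_iff`); given the
    linear lemma they coincide (tree `coreGluing_iff_coreGluingGivenInvertibility`).  Not refutable here
    (`¬ CoreGluing ↔ SkeletonEquilibrium ∧ ¬ RssProfileExists`).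
  - Drop `SkeletonEquilibrium`: the crux becomes `CoreLinearInvertibility → RssProfileExists`, i.e. (granted
    the linear lemma) the open TARGET.  Not refutable.
  - INHERITED from the parent's disprover (import `CoreGluing/Negative/ThresholdLoadBearing`): with the
    supercritical threshold `3/2` of `SkeletonEquilibrium` lowered below the Leray-drift value `1/2`, the
    skeleton hypothesis is inhabited by the bare axis, so `CruxAt θ ↔ (CoreLinearInvertibility → RssProfileExists)`
    for `θ < 1/2` (`cruxAt_iff_of_lt_half`): EVEN WITH THE LINEAR INPUT any proof must use supercriticality
    `w′(τ*) ≥ 3/2 + δ`.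
  - INHERITED from the sibling's disprover (import `CoreLinearInvertibility/Negative/MassZeroLoadBearing`):
    the linear input with its zero-mass constraint deleted is FALSE (`T_{0,R} G = 0`), so the child with that
    STRONGER hypothesis is trivially true (`crux_withoutMassZero_trivial`): the moment constraints of the
    hypothesis are exactly what keeps the child from being vacuous on the linear side.
* **NEW, LANDED (§C): what the linear input can see of the skeleton.**  The crux's dictionary sends
  filament `j` to `(λ_j, R = Γγ_j)`, `λ_j` = asymmetry of the cross strain at `τ*`; the linear input is
  quantified over `λ ∈ [0,1)` only, in the weight `gaussWeightLam λ`, for the operator `L_λ − RΛ_G`.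
  (1) `Negative/GaussianCoreRange` (p166985): classification of the Gaussian steady states of `L_λ`;
  decaying Gaussian cores exist iff `|λ| < 1`; NONE for `λ ≥ 1`, where also `gaussWeightLam λ ≤ 0`.  Every
  certified supercritical skeleton on record is HYPERBOLIC (`λ = 2.16` 2001 `C₃`; `λ = 1.17` the `C₄` line
  datum of stmt-15400, kernel-certified p132466); only the small-separation datum `D*` is elliptic
  (`λ = 0.382`, p132128).  At the certified skeletons the hypothesis is silent (`coreLinearInvertibility_range`).
  (2) `Negative/AmbientRotationTiltCalc` + `Negative/AmbientRotationTilt` (p167429 + p167617): the planar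
  core operator the gluing meets at filament `j` is `L_λ − ω∂_θ − RΛ_G` with `ω = −α⟨t,e₃⟩/γ` (rigid frame
  rotation seen in the cross-section; the induction of the other filaments is irrotational there) — the
  hypothesis is the case `ω = 0`.  Gaussian steady states of `L_λ − ω∂_θ`: UNIQUE and explicit, TILTED iff
  `λω ≠ 0`, decaying iff `λ² < 1 + 4ω²` — the parent lead's Hurwitz criterion `det A⊥ > 0` in closed form
  (frame rotation widens the elliptic window and tilts the core; at `D*`, `ω ≈ 0.30`, `λ ≈ 0.38`: tilted).
  A tilted Gaussian is never a steady state of `L_λ`.  CONSEQUENCE (load-bearing, for provers/planners):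
  to consume the hypothesis a proof needs ELLIPTIC skeletons with `λ_j(Γ) ≤ λ₀ < 1` uniformly in `Γ` AND
  either `⟨t(τ*),e₃⟩ = 0` or a re-derivation of the bound for `L_λ − ω∂_θ − RΛ_G` on a compact `(λ, ω)`-set
  — none of which `SkeletonEquilibrium` exports (it exports `N, γ, α, δ, ρ, K` only).  Statement-design
  remark: the linear item should quantify `(λ, ω)` over a compact subset of `{λ² < 1 + 4ω²}` and include
  `−ω∂_θ`; as typed it is the `ω = 0` slice.
* **Junk audit (§D), independent of the parent's c10 and the sibling's §1.**  `RssProfileExists`: the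
  pinned family `Rot` is consistent (rotations about `e₃`; `Rot 0 = id` forced by linearity on the basis);
  `∀ c > 0, IsRotatedDSS c (Rot (−2α log c)) u` with `u (−1) = U` DETERMINES `u` on `t < 0`
  (`u t x = c • (Rot _).symm (U (c • Rot _ x))`, `c = (−t)^{-1/2}`), jointly continuous for `U ∈ C²`, so
  the `τ`-integrands of `IsMildNSSolutionBetween` are continuous and, under `HasTypeIDecay`, integrable
  (`|u|² |∇e^{(t−τ)Δ}φ|`, `|u| |e^{…}φ|` against Gaussian tails): no Bochner-junk witness and no junk
  refutation; slices at `t ≥ 0` are unconstrained but unused.  `CoreLinearInvertibility`: `C² ∩ L²(G_λ⁻¹)`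
  forces `w, xᵢw ∈ L¹` (Cauchy–Schwarz, `λ < 1`), so the moment hypotheses are honest; `Δ, gradient, fderiv`
  of `C²` maps genuine.  `SkeletonEquilibrium`: every clause but (SC) inhabited by the axis (parent), (SC)
  scale-consistent.  Nothing to exploit.
* **Barriers / literature.**  Catalogue `Literature/Barriers/NavierStokesRegularity/*`: only
  `LeraySelfSimilarBlowupExclusion(Narrow)` touches the conclusion (Pineau–Vicol thresholds existential in
  `C₀`; the crux keeps `α` fixed while `C₀ ≲ Γ^{3/2} → ∞`) — does not bite; no barrier concerns the linear
  input.  `lit search` 2026-08-17 (crossref; OpenAlex/S2 HTTP 429): no all-`α` RSS Liouville theorem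
  (Kwon–Tsai 2021 bifurcation, Bradshaw–Phelps 2023 decay, Hou 2026 — none rotate); Gaussian cores vs
  asymmetry: Burgers `λ = 0`, Moffatt–Kida–Ohkitani 1994 `0 < λ < 1`, Kerr–Dold 1994 plane strain `λ = 1`
  (layer) [corpus book:boratav1997 p. 100]; `λ > 1`: no steady confined vortex at finite Reynolds number.
* **Targets.**  payload `targets = []`; the lead's line `Sketch` has ONE stub, `stub_notSkeletonEquilibrium`,
  owned by stmt-15400's negation lines — not attacked from here (would duplicate that crux's disprover).
-/

set_option linter.dupNamespace false

namespace Summit.NavierStokesRegularity.NavierStokesRegularity.Cruxes.CoreGluingGivenInvertibility.Disproof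

open Summit.NavierStokesRegularity.NavierStokesRegularity.Theses.FilamentSkeletonRss
open Summit.NavierStokesRegularity.NavierStokesRegularity.Theorems
open Literature.Analysis.FluidPDE MeasureTheory
open scoped RealInnerProductSpace InnerProductSpace

/-! ## §A  Structure of the crux -/

/-- The crux unfolds to the double implication between the three closed route propositions. [folklore] -/
theorem crux_iff :
    CoreGluingGivenInvertibility ↔ (CoreLinearInvertibility → SkeletonEquilibrium → RssProfileExists) :=
  Iff.rfl

/-- **Refutation shape.**  `¬ crux` is the conjunction of the sibling lemma, the skeleton theorem as typed,
and the RSS Liouville theorem in the window (tree p151377). [folklore] -/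
theorem not_crux_iff :
    ¬ CoreGluingGivenInvertibility ↔
      (CoreLinearInvertibility ∧ SkeletonEquilibrium ∧ ¬ RssProfileExists) :=
  not_coreGluingGivenInvertibility_iff

/-- Equivalently: a refutation of the child is a proof of the sibling plus a refutation of the parent. [folklore] -/
theorem not_crux_iff' :
    ¬ CoreGluingGivenInvertibility ↔ (CoreLinearInvertibility ∧ ¬ CoreGluing) := by
  unfold CoreGluingGivenInvertibility
  exact Classical.not_imp

/-- What a refutation must supply, component by component. [folklore] -/
theorem not_crux_requires (h : ¬ CoreGluingGivenInvertibility) :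
    CoreLinearInvertibility ∧ SkeletonEquilibrium ∧ ¬ RssProfileExists :=
  not_crux_iff.1 h

/-- Vacuous branch 1: the child holds if the linear lemma fails. [folklore] -/
theorem crux_of_not_coreLinearInvertibility (h : ¬ CoreLinearInvertibility) :
    CoreGluingGivenInvertibility := fun hL => absurd hL h

/-- Vacuous branch 2 (the lead's picked line `Sketch`): the child holds if the skeleton theorem fails. [folklore] -/
theorem crux_of_not_skeletonEquilibrium (h : ¬ SkeletonEquilibrium) : CoreGluingGivenInvertibility :=
  coreGluingGivenInvertibility_of_not_skeletonEquilibrium h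

/-- Target branch: the child holds if the route target holds. [folklore] -/
theorem crux_of_rssProfileExists (h : RssProfileExists) : CoreGluingGivenInvertibility :=
  coreGluingGivenInvertibility_of_rssProfileExists h

/-- Given the (believed true) linear lemma, child and parent coincide: the hypothesis gives no formal
leverage. [folklore] -/
theorem crux_iff_coreGluing (hL : CoreLinearInvertibility) : CoreGluingGivenInvertibility ↔ CoreGluing :=
  (coreGluing_iff_coreGluingGivenInvertibility hL).symm

/-! ## §B  Load-bearing analysis of the hypotheses -/

/-- The crux with the hypothesis `CoreLinearInvertibility` dropped. -/
def CruxWithoutCLI : Prop := SkeletonEquilibrium → RssProfileExists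

/-- … is the parent crux, definitionally. [folklore] -/
theorem withoutCLI_iff : CruxWithoutCLI ↔ CoreGluing := Iff.rfl

/-- The dropped-hypothesis statement is stronger (sanity). [folklore] -/
theorem crux_of_withoutCLI (h : CruxWithoutCLI) : CoreGluingGivenInvertibility := fun _ => h

/-- Why `¬ CruxWithoutCLI` is not provable here: it is `SkeletonEquilibrium ∧ ¬ RssProfileExists`
(parent's `not_coreGluing_iff`). [folklore] -/
theorem not_withoutCLI_iff : ¬ CruxWithoutCLI ↔ (SkeletonEquilibrium ∧ ¬ RssProfileExists) :=
  CoreGluing.Negative.not_coreGluing_iff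

/-- The crux with the hypothesis `SkeletonEquilibrium` dropped. -/
def CruxWithoutSE : Prop := CoreLinearInvertibility → RssProfileExists

/-- The dropped-hypothesis statement is stronger (sanity). [folklore] -/
theorem crux_of_withoutSE (h : CruxWithoutSE) : CoreGluingGivenInvertibility := fun hL _ => h hL

/-- Why `¬ CruxWithoutSE` is not provable here: it is `CoreLinearInvertibility ∧ ¬ RssProfileExists`. [folklore] -/
theorem not_withoutSE_iff : ¬ CruxWithoutSE ↔ (CoreLinearInvertibility ∧ ¬ RssProfileExists) := by
  unfold CruxWithoutSE
  exact Classical.not_imp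

/-- `SkeletonEquilibrium` with the supercritical threshold `3/2` replaced by a parameter `θ` (verbatim
copy of the route decl, last clause `θ + δ ≤ deriv (w j) τs`; the parent disprover's family). -/
def SkeletonEquilibriumAt (θ : ℝ) : Prop :=
  ∃ (N : ℕ) (γ : Fin N → ℝ) (α δ ρ K : ℝ), 0 < N ∧ α ≠ 0 ∧ 0 < δ ∧ 0 < ρ ∧ (∀ j, γ j ≠ 0) ∧ ∀ Γ₀ : ℝ, ∃ Γ : ℝ, Γ₀ ≤ Γ ∧ 0 < Γ ∧ ∃ (Ξ : Fin N → ℝ → EuclideanSpace ℝ (Fin 3)) (w : Fin N → ℝ → ℝ), (∀ j, ContDiff ℝ 2 (Ξ j) ∧ Function.Injective (Ξ j) ∧ Differentiable ℝ (w j) ∧ (∀ τ, ‖deriv (Ξ j) τ‖ = 1) ∧ (∀ τ, ‖iteratedDeriv 2 (Ξ j) τ‖ * Real.sqrt Γ ≤ K) ∧ Filter.Tendsto (fun τ => ‖Ξ j τ‖) Filter.atTop Filter.atTop ∧ Filter.Tendsto (fun τ => ‖Ξ j τ‖) Filter.atBot Filter.atTop) ∧ (∀ j k, j ≠ k → ∀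 τ σ, ρ * Real.sqrt Γ ≤ ‖Ξ j τ - Ξ k σ‖) ∧ (∀ j (x : EuclideanSpace ℝ (Fin 3)), MeasureTheory.Integrable (fun σ : ℝ => ((‖x - Ξ j σ‖ ^ 2 + 1) ^ (3 / 2 : ℝ))⁻¹ • Literature.Analysis.FluidPDE.cross (deriv (Ξ j) σ) (x - Ξ j σ))) ∧ (∀ j τ, (∑ k : Fin N, (Γ * γ k / (4 * Real.pi)) • ∫ σ : ℝ, ((‖Ξ j τ - Ξ k σ‖ ^ 2 + 1) ^ (3 / 2 : ℝ))⁻¹ • Literature.Analysis.FluidPDE.cross (deriv (Ξ k) σ) (Ξ j τ - Ξ k σ)) + (1 / 2 : ℝ) • Ξ j τ - α • Literature.Analysis.FluidPDE.cross (EuclideanSpace.single (2 : Fin 3) (1 : ℝ)) (Ξ j τ) = w j τ • deriv (Ξ j) τ) ∧ (∀ j, ∃ τs : ℝ, w j τs = 0 ∧ (∀ τ, w j τ = 0 → τ = τs) ∧ θ + δ ≤ deriv (w j) τs)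

/-- The threshold family of the child. -/
def CruxAt (θ : ℝ) : Prop := CoreLinearInvertibility → SkeletonEquilibriumAt θ → RssProfileExists

/-- At `θ = 3/2` the family member is the crux, definitionally. [folklore] -/
theorem cruxAt_three_halves_iff : CruxAt (3 / 2) ↔ CoreGluingGivenInvertibility := Iff.rfl

/-- **The supercritical threshold stays load-bearing with the linear input in hand.**  For `θ < 1/2` the
skeleton hypothesis is free (parent disprover's axis witness, tree
`CoreGluing.Negative.skeletonEquilibrium_holds_below_drift`), so the weakened child IS
`CoreLinearInvertibility → RssProfileExists` — granted the linear lemma, the open target.  Any proof of the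
child must use `w′(τ*) ≥ 3/2 + δ`. [folklore] -/
theorem cruxAt_iff_of_lt_half {θ : ℝ} (hθ : θ < 1 / 2) :
    CruxAt θ ↔ (CoreLinearInvertibility → RssProfileExists) :=
  ⟨fun h hL => h hL (CoreGluing.Negative.skeletonEquilibrium_holds_below_drift hθ), fun h hL _ => h hL⟩

/-- The family is monotone in the threshold (larger threshold = weaker statement). [folklore] -/
theorem CruxAt.mono {θ θ' : ℝ} (hle : θ ≤ θ') (h : CruxAt θ) : CruxAt θ' := by
  intro hL hS
  refine h hL ?_
  obtain ⟨N, γ, α, δ, ρ, K, hN, hα, hδ, hρ, hγ, H⟩ := hS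
  refine ⟨N, γ, α, δ, ρ, K, hN, hα, hδ, hρ, hγ, fun Γ₀ => ?_⟩
  obtain ⟨Γ, h1, h2, Ξ, w, hA, hB, hC, hD, hE⟩ := H Γ₀
  refine ⟨Γ, h1, h2, Ξ, w, hA, hB, hC, hD, fun j => ?_⟩
  obtain ⟨τs, h0, huniq, hsc⟩ := hE j
  exact ⟨τs, h0, huniq, by linarith⟩

/-- `CoreLinearInvertibility` with its zero-mass hypothesis `∫ w = 0` DELETED (verbatim otherwise; the
sibling disprover's statement). -/
def CLIWithoutMassZero : Prop :=
  ∀ lam ∈ Set.Ico (0 : ℝ) 1, ∃ R₀ c : ℝ, 0 < c ∧ ∀ R : ℝ, R₀ ≤ R →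
    ∀ w : EuclideanSpace ℝ (Fin 2) → ℝ, ContDiff ℝ 2 w →
    Integrable (fun x => (gaussWeightLam lam x)⁻¹ * w x ^ 2) →
    (∀ x, Integrable (fun y => w y • biotSavartKernel2D (x - y))) →
    Integrable (fun x => (gaussWeightLam lam x)⁻¹ *
      (strainedVorticityOperator lam w x - R * (⟪gaussVortexVelocity x, gradient w x⟫ +
        ⟪biotSavart2D w x, gradient gaussVortexProfile x⟫)) ^ 2) →
    ∫ x, x 0 * w x = 0 → ∫ x, x 1 * w x = 0 →
    c ^ 2 * ∫ x, (gaussWeightLam lam x)⁻¹ * w x ^ 2 ≤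
      ∫ x, (gaussWeightLam lam x)⁻¹ *
        (strainedVorticityOperator lam w x - R * (⟪gaussVortexVelocity x, gradient w x⟫ +
          ⟪biotSavart2D w x, gradient gaussVortexProfile x⟫)) ^ 2

/-- The deleted-constraint linear statement is FALSE (sibling's landed lemma, p164434: `T_{0,R} G = 0`). [folklore] -/
theorem cliWithoutMassZero_false : ¬ CLIWithoutMassZero :=
  CoreLinearInvertibility.Negative.coreLinearInvertibility_false_without_massZero

/-- **Hence the child with the STRENGTHENED linear hypothesis is trivially true**: the zero-mass constraint
of the hypothesis is what keeps the child honest on the linear side. [folklore] -/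
theorem crux_withoutMassZero_trivial : CLIWithoutMassZero → CoreGluing :=
  fun h => absurd h cliWithoutMassZero_false

/-! ## §C  What the linear input can see of the skeleton (landed under `Theorems/…/Negative/`) -/

/-- (1) Range.  The linear input makes no claim at any `λ ≥ 1` (`Set.Ico 0 1`), and at such asymmetry
there is no decaying Gaussian steady state of `L_λ` at all (landed `no_decaying_gaussianCore_of_one_le`):
the certified skeletons (`λ = 2.16`, `1.17`) are invisible to the hypothesis. [folklore] -/
theorem linearInput_silent_at_hyperbolic {lam a b k : ℝ} (hlam : 1 ≤ lam) (hk : k ≠ 0)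
    (ha : 0 < a) (hb : 0 < b) :
    lam ∉ Set.Ico (0 : ℝ) 1 ∧
      ¬ ∀ x, strainedVorticityOperator lam (fun y : EuclideanSpace ℝ (Fin 2) =>
        k * Real.exp (-(a * y 0 ^ 2 + b * y 1 ^ 2))) x = 0 :=
  ⟨CoreGluingGivenInvertibility.Negative.coreLinearInvertibility_range hlam,
    CoreGluingGivenInvertibility.Negative.no_decaying_gaussianCore_of_one_le hlam hk ha hb⟩

/-- (1′) Elliptic range.  Conversely a decaying Gaussian core forces `|λ| < 1` (landed
`gaussianCore_asymmetry_lt_one`). [folklore] -/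
theorem gaussianCore_needs_elliptic {lam a b k : ℝ} (hk : k ≠ 0) (ha : 0 < a) (hb : 0 < b)
    (h : ∀ x, strainedVorticityOperator lam (fun y : EuclideanSpace ℝ (Fin 2) =>
        k * Real.exp (-(a * y 0 ^ 2 + b * y 1 ^ 2))) x = 0) :
    -1 < lam ∧ lam < 1 :=
  CoreGluingGivenInvertibility.Negative.gaussianCore_asymmetry_lt_one hk ha hb h

/-- (2) Ambient rotation — the Hurwitz window in numbers (pure arithmetic instance of the landed
`gaussianCoreRot_decaying_iff`: decaying core iff `λ² < 1 + 4ω²`).  `λ = 6/5` is rescued by `ω = 2/5`, not by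
`ω = 3/10`; with `ω = 0` (the hypothesis' operator) no `λ ≥ 1` is admissible. [folklore] -/
theorem hurwitz_window_examples :
    ((6 / 5 : ℝ) ^ 2 < 1 + 4 * (2 / 5 : ℝ) ^ 2) ∧ ¬ ((6 / 5 : ℝ) ^ 2 < 1 + 4 * (3 / 10 : ℝ) ^ 2) ∧
      ∀ lam : ℝ, 1 ≤ lam → ¬ (lam ^ 2 < 1 + 4 * (0 : ℝ) ^ 2) := by
  refine ⟨by norm_num, by norm_num, fun lam hl h => ?_⟩
  nlinarith

/-! ## §D  Junk audit witnesses -/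

/-- The pinning clause of `RssProfileExists` forces `Rot 0 = id` (linearity on the standard basis): the
symmetry clause at `c = 1` is then the tautology `IsRotatedDSS 1 (refl)`, consistent. [folklore] -/
theorem rot_zero_eq_refl (Rot : ℝ → (EuclideanSpace ℝ (Fin 3) ≃ₗᵢ[ℝ] EuclideanSpace ℝ (Fin 3)))
    (hRot : ∀ θ : ℝ, Rot θ (EuclideanSpace.single 0 1) =
        Real.cos θ • EuclideanSpace.single 0 1 + Real.sin θ • EuclideanSpace.single 1 1 ∧
      Rot θ (EuclideanSpace.single 1 1) =
        -(Real.sin θ • EuclideanSpace.single 0 1) + Real.cos θ • EuclideanSpace.single 1 1 ∧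
      Rot θ (EuclideanSpace.single 2 1) = EuclideanSpace.single 2 1) :
    Rot 0 = LinearIsometryEquiv.refl ℝ (EuclideanSpace ℝ (Fin 3)) := by
  obtain ⟨h0, h1, h2⟩ := hRot 0
  simp only [Real.cos_zero, Real.sin_zero, one_smul, zero_smul, add_zero, neg_zero, zero_add] at h0 h1
  apply LinearIsometryEquiv.ext
  intro x
  have hx : x = x 0 • EuclideanSpace.single (0 : Fin 3) (1 : ℝ) + x 1 • EuclideanSpace.single 1 1 +
      x 2 • EuclideanSpace.single 2 1 := by
    ext i; fin_cases i <;> simp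
  rw [hx]
  simp only [map_add, map_smul, h0, h1, h2, LinearIsometryEquiv.coe_refl, id_eq]

/-- Time–scale bookkeeping of the symmetry clause: for `t < 0` the factor `c = (−t)^{-1/2}` is positive and
`c² t = −1`, so `IsRotatedDSS c _ u` evaluated at time `−1/c² … ` pins `u t` to the slice `u (−1) = U` — the
field on `t < 0` is determined by `U` (no freedom for Bochner junk in the duality identity). [folklore] -/
theorem rescale_time_to_minus_one {t : ℝ} (ht : t < 0) :
    0 < (Real.sqrt (-t))⁻¹ ∧ ((Real.sqrt (-t))⁻¹) ^ 2 * t = -1 := by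
  have hs : 0 < Real.sqrt (-t) := Real.sqrt_pos.2 (by linarith)
  refine ⟨inv_pos.2 hs, ?_⟩
  rw [inv_pow, Real.sq_sqrt (by linarith : (0 : ℝ) ≤ -t), inv_neg, neg_mul, inv_mul_cancel₀ ht.ne]

/-- The determination itself: under the symmetry clause for every factor, each negative-time slice is a
rescaled rotated copy of `u (−1)`. [folklore] -/
theorem slice_determined_by_profile
    {Rot : ℝ → (EuclideanSpace ℝ (Fin 3) ≃ₗᵢ[ℝ] EuclideanSpace ℝ (Fin 3))}
    {u : ℝ → EuclideanSpace ℝ (Fin 3) → EuclideanSpace ℝ (Fin 3)} {α : ℝ}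
    (hrss : ∀ c : ℝ, 0 < c → IsRotatedDSS c (Rot (-(α * (2 * Real.log c)))) u) {t : ℝ} (ht : t < 0)
    (x : EuclideanSpace ℝ (Fin 3)) :
    u t x = (Real.sqrt (-t))⁻¹ •
      (Rot (-(α * (2 * Real.log (Real.sqrt (-t))⁻¹)))).symm
        (u (-1) ((Real.sqrt (-t))⁻¹ • Rot (-(α * (2 * Real.log (Real.sqrt (-t))⁻¹))) x)) := by
  obtain ⟨hc, hct⟩ := rescale_time_to_minus_one ht
  have key := hrss _ hc t x
  rw [hct] at key
  exact key.symm

end Summit.NavierStokesRegularity.NavierStokesRegularity.Cruxes.CoreGluingGivenInvertibility.Disproof
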